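import Mathlib.NumberTheory.Primorial
import Literature.NumberTheory.LFunctions.RobinNumerical
import HarnessLib

/-!
# Morrill–Platt 2021: Robin's inequality verified up to `29 996 208 012 611#` (named fact)

Topic: `Literature/NumberTheory/LFunctions`. Companion of `RobinCriterion.lean` / `RobinBriggsRange.lean`.
T. Morrill, D. J. Platt, *Robin's inequality for 20-free integers*, INTEGERS 21 (2021) #A28, §4,
**Theorem 5** ("Robin's inequality holds for all `5040 < n ≤ 10^(10^13.11485)`" — "We implemented Brigg's
algorithm … using extended precision (100 bits) and interval arithmetic … The final `n` checked was
`29 996 208 012 611# · 7 662 961# · 44 293# · … · (3#)¹⁰ · 2¹⁹`") and **Corollary 2** ("Robin's inequality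
holds for all `13# ≤ n ≤ 29 996 208 012 611#`"), where `p#` is the primorial. This is the computational
input of every refereed `t`-free Robin theorem with `t ≥ 20` (Morrill–Platt Thm 2, `t = 20`; Axler 2023,
Lemma 2.3 and Thm 1.2, `t = 21`, with `k₀ = 999 999 476 056`, `p_{k₀} = 29 996 208 012 611`) and the
hypothesis `(H1)` of the rh-explicit calibration row B-ROBIN-CAL-24.

* `MorrillPlatt2021_cor2` — NAMED FACT (nothing asserted): Robin's inequality for
  `13# ≤ n ≤ 29 996 208 012 611#`, with Mathlib's `primorial`.
* `MorrillPlatt2021_cor2.robinInequality_of_le` — PROVED consequence: Robin's inequality for every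
  `5040 < n ≤ 29 996 208 012 611#` (below `13# = 30030` the tree's certificate
  `robinInequality_le_55440` of `RobinNumerical.lean` takes over).

The fact extends, and is consistent with, the tree's kernel-certified range
`robinInequality_le_ten_pow_1958000` (`RobinBriggsRange.lean`) and the named fact
`Briggs2006_robinInequality_le` (`10^(10^10)`); it is a finite floating-point/interval computation that
the kernel does not replay (≈ `10¹²` colossally abundant steps).

## References

* [MorrillPlatt2021] T. Morrill, D. J. Platt, INTEGERS 21 (2021) #A28, Thm. 5 and Cor. 2 (p. 6)
  [corpus:paper:url-b2952759ad78 p0006:L6–12].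
* C. Axler, Ramanujan J. 61 (2023) 909–919, Lemma 2.3 (the same range, quoted with `k₀`, `p_{k₀}`).
-/

noncomputable section

open Real

namespace Literature.NumberTheory.LFunctions

/-- NAMED FACT, computational (Morrill–Platt 2021, Corollary 2, as printed: "Robin's inequality holds
for all `13# ≤ n ≤ 29 996 208 012 611#`"; from their Theorem 5, a 100-bit interval-arithmetic run of
Briggs' colossally-abundant-number algorithm whose final `n` exceeds `10^(10^13.11485)`, and Robin 1984
§3 Prop. 1). `primorial k = ∏_{p ≤ k} p`. Users take `(h : MorrillPlatt2021_cor2)`; the numbers are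
astronomically large — never hand them to `decide`/`norm_num`.
[cite: MorrillPlatt2021, Cor. 2 (and Thm. 5), p. 6] -/
def MorrillPlatt2021_cor2 : Prop :=
  ∀ n : ℕ, primorial 13 ≤ n → n ≤ primorial 29996208012611 → robinInequality n

namespace MorrillPlatt2021_cor2

/-- `13# = 30030` (private arithmetic helper). [folklore] -/
private theorem primorial_thirteen : primorial 13 = 30030 := by
  decide

/-- Robin's inequality for every `5040 < n ≤ 29 996 208 012 611#`, from Morrill–Platt's Corollary 2
and, below `13# = 30030 ≤ 55440`, the tree's certified check `robinInequality_le_55440`.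
[cite: MorrillPlatt2021, Cor. 2 (and Thm. 5), p. 6] -/
theorem robinInequality_of_le (h : MorrillPlatt2021_cor2) {n : ℕ} (hn : 5040 < n)
    (hle : n ≤ primorial 29996208012611) : robinInequality n := by
  by_cases h13 : primorial 13 ≤ n
  · exact h n h13 hle
  · have hlt : n < 30030 := by rw [← primorial_thirteen]; exact not_le.mp h13
    exact robinInequality_le_55440 n hn (by omega)

end MorrillPlatt2021_cor2

end Literature.NumberTheory.LFunctions

end
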